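import Literature.NumberTheory.LFunctions.ExceptionalPrimesAbel
import HarnessLib

/-!
# The mean value of `ζ ⋆ χ`: `∑_{n ≤ N} (ζ ⋆ χ)(n) = N L(1, χ) + O(q √N)` (Dirichlet's hyperbola method)

Topic `Literature/NumberTheory/LFunctions`. Everything in this file is PROVED.

For a non-principal Dirichlet character `χ` mod `q` let `r(n) = (ζ ⋆ χ)(n) = ∑_{d ∣ n} χ(d)`
(Mathlib's `DirichletCharacter.zetaMul χ`). Writing `∑_{n ≤ N} r(n) = ∑_{d ≤ N} χ(d) ⌊N/d⌋`
(`sum_zetaMul_eq_sum_mul_div`) and splitting at `y = ⌊√N⌋` (Dirichlet's hyperbola method,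
Montgomery–Vaughan §2.1 (2.9)) one gets, using only `|∑_{a < n ≤ b} χ(n)| ≤ 2q` (MV (4.23), the
tree's `Literature.NumberTheory.LFunctions.SiegelZero.norm_sum_Ioc_apply_le`) and the finite Abel bound
with the monotone weights `⌊N/d⌋` resp. `1/d` (`SiegelZero.norm_sum_Ioc_mul_le`):

* `Literature.NumberTheory.LFunctions.ZetaMul.norm_sum_zetaMul_sub_le` — for `χ ≠ 1` and all `N`,
  `‖∑_{n ≤ N} r(n) − N · L(1, χ)‖ ≤ 5 q √N`;
* `Literature.NumberTheory.LFunctions.ZetaMul.norm_LFunction_one_sub_sum_le` — the tail bound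
  `‖L(1, χ) − ∑_{n ≤ y} χ(n)/n‖ ≤ 2q/(y+1)` (from the tree's conditional convergence
  `SiegelZero.tendsto_sum_Icc_mul_cpow` and finite Abel bound `SiegelZero.norm_sum_Ioc_mul_le`,
  `Literature/NumberTheory/LFunctions/ExceptionalPrimesAbel.lean`);
* for a quadratic `χ ≠ 1` the real-valued packaging used by the sieve files: `coeff χ n = r(n) ≥ 0`
  (an `ArithmeticFunction ℝ`, multiplicative: `coeffAF`, `isMultiplicative_coeffAF`),
  `convSum χ N = ∑_{n ≤ N} r(n)`, `LOne χ = L(1, χ) > 0`, and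
  `|convSum χ N − N · LOne χ| ≤ 5 q √N` (`abs_convSum_sub_le`).

These are the inputs "`S₀(t) = t L(1,χ) + O(√(qt))`" of the tree's proof of Motohashi's theorem
on the Brun–Titchmarsh constant and Siegel zeros (`Literature/Barriers/Parity/BrunTitchmarshSiegelZero.lean`).
The constant `5` and the exponent `√N` are what the trivial bound `|∑ χ| ≤ q` gives; Pólya–Vinogradov
would give `O(N^{1/2} q^{1/4} log q)`-type improvements which are not needed.

## References

* H. L. Montgomery, R. C. Vaughan, *Multiplicative Number Theory I*, CUP 2007, §1.3 Thm. 1.3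
  (Abel summation), §2.1 (hyperbola method, (2.9)), §4.3 (4.23) and Thm. 4.8.
  [cite: MontgomeryVaughan2007, §4.3 eq. (4.23) and Thm. 4.8; §2.1 eq. (2.9)]

## Design choices

* All sums over `1 ≤ n ≤ N` are `Finset.Ioc 0 N`; the splitting parameter is `Nat.sqrt N`.
* The complex estimate `norm_sum_zetaMul_sub_le` holds for every `χ ≠ 1`; realness is only used
  in the final real-valued corollary for quadratic characters.
-/

noncomputable section

open Complex Filter Topology Finset
open scoped ComplexOrder

namespace Literature.NumberTheory.LFunctions.ZetaMul

open DirichletAbel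

/-! ### Abel summation over `Ioc a b` -/

/-- **Abel summation on `(a, b]`** for arbitrary coefficients: with `C(k) = ∑_{a < j ≤ k} c_j`,
`∑_{a<k≤b} c_k g(k) = C(b) g(b+1) + ∑_{a<k≤b} C(k) (g(k) − g(k+1))` (the tree's
`SiegelZero.sum_Ioc_mul_eq_abel` is the case `c = χ`). [cite: MontgomeryVaughan2007, §1.3 Thm. 1.3] -/
theorem sum_Ioc_mul_eq_abel {R : Type*} [CommRing R] (c g : ℕ → R) (a b : ℕ) :
    ∑ k ∈ Ioc a b, c k * g k =
      (∑ j ∈ Ioc a b, c j) * g (b + 1) +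
        ∑ k ∈ Ioc a b, (∑ j ∈ Ioc a k, c j) * (g k - g (k + 1)) := by
  rcases le_or_gt a b with hab | hab
  · obtain ⟨n, rfl⟩ := Nat.exists_eq_add_of_le hab
    induction n with
    | zero => simp
    | succ n ih =>
      have h : a ≤ a + n := Nat.le_add_right a n
      rw [← add_assoc, Finset.sum_Ioc_succ_top h, Finset.sum_Ioc_succ_top h,
        Finset.sum_Ioc_succ_top h, ih h, Finset.sum_Ioc_succ_top h]
      ring
  · simp [Finset.Ioc_eq_empty_of_le hab.le]

/-! ### The tail of `L(1, χ)` -/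

variable {q : ℕ} (χ : DirichletCharacter ℂ q)

/-- The partial sums of `∑ χ(n)/n` over `Ioc 0 K` tend to `L(1, χ)`. [cite: MontgomeryVaughan2007, §4.3 Thm. 4.8] -/
theorem tendsto_sum_Ioc_div [NeZero q] (hχ : χ ≠ 1) :
    Tendsto (fun K : ℕ => ∑ n ∈ Ioc 0 K, χ (n : ZMod q) * ((1 / (n : ℝ) : ℝ) : ℂ)) atTop
      (𝓝 (χ.LFunction 1)) := by
  have h := SiegelZero.tendsto_sum_Icc_mul_cpow χ hχ (s := 1) (by simp)
  refine h.congr fun K => ?_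
  rw [show Finset.Icc 1 K = Finset.Ioc 0 K from (Finset.Icc_add_one_left_eq_Ioc 0 K)]
  refine Finset.sum_congr rfl fun n _ => ?_
  rw [cpow_neg_one]
  push_cast
  ring

/-- **Tail of `L(1, χ)`**: `‖L(1, χ) − ∑_{n ≤ y} χ(n)/n‖ ≤ 2q/(y+1)` (Abel's inequality with the
weights `1/n` on `(y, K]`, then `K → ∞`). [cite: MontgomeryVaughan2007, §4.3 Thm. 4.8] -/
theorem norm_LFunction_one_sub_sum_le [NeZero q] (hχ : χ ≠ 1) (y : ℕ) :
    ‖χ.LFunction 1 - ∑ n ∈ Ioc 0 y, χ (n : ZMod q) * ((1 / (n : ℝ) : ℝ) : ℂ)‖ ≤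
      2 * q / (y + 1) := by
  have hlim := (tendsto_sum_Ioc_div χ hχ).sub_const
    (∑ n ∈ Ioc 0 y, χ (n : ZMod q) * ((1 / (n : ℝ) : ℝ) : ℂ))
  refine le_of_tendsto (Filter.Tendsto.norm hlim) (Filter.eventually_atTop.mpr ⟨y, fun K hyK => ?_⟩)
  rw [← Finset.sum_Ioc_consecutive _ (Nat.zero_le y) hyK, add_sub_cancel_left]
  have := SiegelZero.norm_sum_Ioc_mul_le χ hχ (a := fun n : ℕ => 1 / (n : ℝ)) (N := y)
    (fun k _ => by positivity)
    (fun k hk => by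
      have hk0 : (0 : ℝ) < k := by exact_mod_cast (Nat.zero_le y).trans_lt hk
      push_cast
      exact one_div_le_one_div_of_le hk0 (by linarith)) K
  refine this.trans (le_of_eq ?_)
  push_cast
  ring

/-! ### The hyperbola identity and the mean value -/

/-- `∑_{n ≤ N} (ζ ⋆ χ)(n) = ∑_{d ≤ N} χ(d) ⌊N/d⌋` (swap the order of summation in
`r(n) = ∑_{d ∣ n} χ(d)`; `#{n ≤ N : d ∣ n} = ⌊N/d⌋` is Mathlib's `Nat.Ioc_filter_dvd_card_eq_div`).
[cite: MontgomeryVaughan2007, §2.1 eq. (2.9)] -/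
theorem sum_zetaMul_eq_sum_mul_div (N : ℕ) :
    ∑ n ∈ Ioc 0 N, χ.zetaMul n = ∑ d ∈ Ioc 0 N, χ (d : ZMod q) * ((N / d : ℕ) : ℂ) := by
  have h1 : ∀ n ∈ Ioc 0 N, χ.zetaMul n = ∑ d ∈ n.divisors, χ (d : ZMod q) := by
    intro n hn
    rw [DirichletCharacter.zetaMul, ArithmeticFunction.coe_zeta_mul_apply]
    refine Finset.sum_congr rfl fun d hd => ?_
    have hd0 : d ≠ 0 := Nat.pos_iff_ne_zero.mp (Nat.pos_of_mem_divisors hd)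
    simp [toArithmeticFunction, hd0]
  rw [Finset.sum_congr rfl h1]
  rw [Finset.sum_comm' (t' := Ioc 0 N) (s' := fun d => (Ioc 0 N).filter (d ∣ ·))]
  · refine Finset.sum_congr rfl fun d _ => ?_
    rw [Finset.sum_const, nsmul_eq_mul, mul_comm, Nat.Ioc_filter_dvd_card_eq_div]
  · intro n d
    simp only [Finset.mem_Ioc, Nat.mem_divisors, Finset.mem_filter]
    constructor
    · rintro ⟨⟨hn0, hnN⟩, hdn, hn⟩
      have hd0 : 0 < d := Nat.pos_of_ne_zero fun h => hn (Nat.eq_zero_of_zero_dvd (h ▸ hdn))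
      exact ⟨⟨⟨hn0, hnN⟩, hdn⟩, hd0, (Nat.le_of_dvd hn0 hdn).trans hnN⟩
    · rintro ⟨⟨⟨hn0, hnN⟩, hdn⟩, _, _⟩
      exact ⟨⟨hn0, hnN⟩, hdn, Nat.pos_iff_ne_zero.mp hn0⟩

/-- Piece A of the hyperbola method: replacing `⌊N/d⌋` by `N/d` for `d ≤ y` costs at most `y`:
`‖∑_{d ≤ y} χ(d)⌊N/d⌋ − N ∑_{d ≤ y} χ(d)/d‖ ≤ y`. [cite: MontgomeryVaughan2007, §2.1 eq. (2.9)] -/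
theorem norm_sum_mul_div_sub_le (N y : ℕ) :
    ‖∑ d ∈ Ioc 0 y, χ (d : ZMod q) * ((N / d : ℕ) : ℂ) -
        N * ∑ d ∈ Ioc 0 y, χ (d : ZMod q) * ((1 / (d : ℝ) : ℝ) : ℂ)‖ ≤ y := by
  rw [Finset.mul_sum, ← Finset.sum_sub_distrib]
  refine (norm_sum_le _ _).trans ?_
  have : ∀ d ∈ Ioc 0 y, ‖χ (d : ZMod q) * ((N / d : ℕ) : ℂ) -
      N * (χ (d : ZMod q) * ((1 / (d : ℝ) : ℝ) : ℂ))‖ ≤ 1 := by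
    intro d hd
    rw [Finset.mem_Ioc] at hd
    have hd0 : (0 : ℝ) < d := by exact_mod_cast hd.1
    have e : χ (d : ZMod q) * ((N / d : ℕ) : ℂ) - N * (χ (d : ZMod q) * ((1 / (d : ℝ) : ℝ) : ℂ)) =
        χ (d : ZMod q) * ((((N / d : ℕ) : ℝ) - N / d : ℝ) : ℂ) := by
      push_cast
      ring
    rw [e, norm_mul, Complex.norm_real]
    refine mul_le_one₀ (χ.norm_le_one _) (norm_nonneg _) ?_
    rw [Real.norm_eq_abs, abs_sub_comm, abs_le]
    constructor
    · have := Nat.cast_div_le (m := N) (n := d) (α := ℝ)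
      linarith
    · have h1 : (N : ℝ) / d - 1 < ((N / d : ℕ) : ℝ) := by
        have := Nat.lt_div_mul_add (a := N) hd.1
        have h2 : (N : ℝ) < ((N / d : ℕ) : ℝ) * d + d := by exact_mod_cast this
        rw [div_sub_one hd0.ne', div_lt_iff₀ hd0]
        linarith
      linarith
  refine (Finset.sum_le_sum this).trans ?_
  simp

/-- Piece B of the hyperbola method: `‖∑_{y < d ≤ N} χ(d) ⌊N/d⌋‖ ≤ 2q ⌊N/(y+1)⌋` (Abel's
inequality with the non-increasing weights `⌊N/d⌋`). [cite: MontgomeryVaughan2007, §2.1 eq. (2.9); §4.3 (4.23)] -/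
theorem norm_sum_Ioc_mul_div_le [NeZero q] (hχ : χ ≠ 1) (N y : ℕ) :
    ‖∑ d ∈ Ioc y N, χ (d : ZMod q) * ((N / d : ℕ) : ℂ)‖ ≤ 2 * q * ((N / (y + 1) : ℕ) : ℝ) := by
  have := SiegelZero.norm_sum_Ioc_mul_le χ hχ (a := fun d : ℕ => ((N / d : ℕ) : ℝ)) (N := y)
    (fun k _ => by positivity)
    (fun k hk => by
      have hk0 : 0 < k := (Nat.zero_le y).trans_lt hk
      exact_mod_cast Nat.div_le_div_left (Nat.le_succ k) hk0) N
  refine le_trans (le_of_eq ?_) this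
  push_cast
  rfl

/-- **Mean value of `ζ ⋆ χ`** (hyperbola method with `y = ⌊√N⌋`): for `χ ≠ 1` mod `q` and every `N`,
`‖∑_{n ≤ N} (ζ ⋆ χ)(n) − N L(1, χ)‖ ≤ 5 q √N`. [cite: MontgomeryVaughan2007, §2.1 eq. (2.9); §4.3 (4.23), Thm. 4.8] -/
theorem norm_sum_zetaMul_sub_le [NeZero q] (hχ : χ ≠ 1) (N : ℕ) :
    ‖∑ n ∈ Ioc 0 N, χ.zetaMul n - N * χ.LFunction 1‖ ≤ 5 * q * Real.sqrt N := by
  rcases Nat.eq_zero_or_pos N with rfl | hN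
  · simp
  set y := Nat.sqrt N with hy
  have hy1 : 1 ≤ y := Nat.le_sqrt.mpr (by rw [one_mul]; exact hN)
  have hyN : y ≤ N := Nat.sqrt_le_self N
  have hq1 : (1 : ℝ) ≤ q := by exact_mod_cast NeZero.one_le
  have hsqN : Real.sqrt N * Real.sqrt N = N := Real.mul_self_sqrt (Nat.cast_nonneg N)
  have hsq0 : 0 < Real.sqrt N := Real.sqrt_pos.mpr (by exact_mod_cast hN)
  -- `y ≤ √N` and `N/(y+1) ≤ √N`
  have hy_le : (y : ℝ) ≤ Real.sqrt N := by
    have h : y * y ≤ N := Nat.sqrt_le N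
    rw [Real.le_sqrt (Nat.cast_nonneg y) (Nat.cast_nonneg N), pow_two]
    exact_mod_cast h
  have hy_lt : Real.sqrt N < (y : ℝ) + 1 := by
    have h : N < (y + 1) * (y + 1) := Nat.lt_succ_sqrt N
    rw [Real.sqrt_lt' (by positivity), pow_two]
    exact_mod_cast h
  have hdiv_le : ((N / (y + 1) : ℕ) : ℝ) ≤ Real.sqrt N := by
    refine (Nat.cast_div_le).trans ?_
    push_cast
    rw [div_le_iff₀ (by positivity)]
    nlinarith
  -- decomposition
  set L := χ.LFunction 1
  set A := ∑ d ∈ Ioc 0 y, χ (d : ZMod q) * ((N / d : ℕ) : ℂ)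
  set B := ∑ d ∈ Ioc y N, χ (d : ZMod q) * ((N / d : ℕ) : ℂ)
  set P := ∑ d ∈ Ioc 0 y, χ (d : ZMod q) * ((1 / (d : ℝ) : ℝ) : ℂ)
  have hT : ∑ n ∈ Ioc 0 N, χ.zetaMul n = A + B := by
    rw [sum_zetaMul_eq_sum_mul_div, ← Finset.sum_Ioc_consecutive _ (Nat.zero_le y) hyN]
  have hdecomp : ∑ n ∈ Ioc 0 N, χ.zetaMul n - N * L =
      (A - N * P) + B + N * (P - L) := by rw [hT]; ring
  rw [hdecomp]
  have hA : ‖A - N * P‖ ≤ y := norm_sum_mul_div_sub_le χ N y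
  have hB : ‖B‖ ≤ 2 * q * Real.sqrt N :=
    (norm_sum_Ioc_mul_div_le χ hχ N y).trans (mul_le_mul_of_nonneg_left hdiv_le (by positivity))
  have hC : ‖(N : ℂ) * (P - L)‖ ≤ 2 * q * Real.sqrt N := by
    rw [norm_mul, Complex.norm_natCast, norm_sub_rev]
    have h1 := norm_LFunction_one_sub_sum_le χ hχ y
    calc (N : ℝ) * ‖L - P‖ ≤ N * (2 * q / (y + 1)) := mul_le_mul_of_nonneg_left h1 (Nat.cast_nonneg N)
      _ = 2 * q * (N / (y + 1)) := by ring
      _ ≤ 2 * q * Real.sqrt N := by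
          refine mul_le_mul_of_nonneg_left ?_ (by positivity)
          rw [div_le_iff₀ (by positivity)]
          nlinarith
  calc ‖A - N * P + B + N * (P - L)‖ ≤ ‖A - N * P‖ + ‖B‖ + ‖(N : ℂ) * (P - L)‖ := norm_add₃_le
    _ ≤ y + 2 * q * Real.sqrt N + 2 * q * Real.sqrt N := by linarith
    _ ≤ Real.sqrt N + 2 * q * Real.sqrt N + 2 * q * Real.sqrt N := by linarith
    _ ≤ 5 * q * Real.sqrt N := by nlinarith

/-! ### Real-valued packaging for quadratic characters -/

/-- For quadratic `χ`, `(ζ ⋆ χ)(n)` is real (it is `≥ 0` in `ComplexOrder`, Mathlib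
`DirichletCharacter.zetaMul_nonneg`). [folklore] -/
theorem zetaMul_im_eq_zero (hq : χ ^ 2 = 1) (n : ℕ) : (χ.zetaMul n).im = 0 :=
  ((Complex.nonneg_iff.mp (DirichletCharacter.zetaMul_nonneg hq n)).2).symm

/-- `coeff χ n = r(n) = (ζ ⋆ χ)(n)` as a real number (the real part). [folklore] -/
def coeff (n : ℕ) : ℝ := (χ.zetaMul n).re

/-- `r(n) ≥ 0` for quadratic `χ`. [folklore] -/
theorem coeff_nonneg (hq : χ ^ 2 = 1) (n : ℕ) : 0 ≤ coeff χ n :=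
  (Complex.nonneg_iff.mp (DirichletCharacter.zetaMul_nonneg hq n)).1

/-- `(coeff χ n : ℂ) = (ζ ⋆ χ)(n)` for quadratic `χ`. [folklore] -/
theorem ofReal_coeff (hq : χ ^ 2 = 1) (n : ℕ) : (coeff χ n : ℂ) = χ.zetaMul n :=
  Complex.ext (by simp [coeff]) (by simp [zetaMul_im_eq_zero χ hq n])

/-- `coeff χ 0 = 0`. [folklore] -/
@[simp] theorem coeff_zero : coeff χ 0 = 0 := by simp [coeff]

/-- `r(1) = 1`. [folklore] -/
@[simp] theorem coeff_one : coeff χ 1 = 1 := by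
  simp [coeff, χ.isMultiplicative_zetaMul.map_one]

/-- At a prime, `r(p) = 1 + χ(p)` (real part). [folklore] -/
theorem coeff_prime {p : ℕ} (hp : p.Prime) : coeff χ p = 1 + (χ (p : ZMod q)).re := by
  rw [coeff, DirichletCharacter.zetaMul, ArithmeticFunction.coe_zeta_mul_apply, hp.divisors,
    Finset.sum_pair hp.one_lt.ne]
  simp [toArithmeticFunction, hp.ne_zero]

/-- `r` as a real arithmetic function. [folklore] -/
def coeffAF : ArithmeticFunction ℝ := ⟨fun n => coeff χ n, by simp⟩

/-- `coeffAF χ n = coeff χ n`. [folklore] -/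
@[simp] theorem coeffAF_apply (n : ℕ) : coeffAF χ n = coeff χ n := rfl

/-- `r = ζ ⋆ χ` is multiplicative (real form, quadratic `χ`). [folklore] -/
theorem isMultiplicative_coeffAF (hq : χ ^ 2 = 1) : (coeffAF χ).IsMultiplicative := by
  refine ⟨by simp, fun {m n} hmn => ?_⟩
  have h := χ.isMultiplicative_zetaMul.map_mul_of_coprime hmn
  apply_fun Complex.re at h
  rw [Complex.mul_re, zetaMul_im_eq_zero χ hq m, zero_mul, sub_zero] at h
  simpa [coeff] using h

/-- `convSum χ N = ∑_{n ≤ N} r(n)` (real). [folklore] -/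
def convSum (N : ℕ) : ℝ := ∑ n ∈ Ioc 0 N, coeff χ n

/-- `(convSum χ N : ℂ) = ∑_{n ≤ N} (ζ ⋆ χ)(n)`. [folklore] -/
theorem ofReal_convSum (hq : χ ^ 2 = 1) (N : ℕ) :
    (convSum χ N : ℂ) = ∑ n ∈ Ioc 0 N, χ.zetaMul n := by
  rw [convSum, ofReal_sum]
  exact Finset.sum_congr rfl fun n _ => ofReal_coeff χ hq n

/-- `convSum` is monotone in `N` (the terms are `≥ 0`). [folklore] -/
theorem convSum_mono (hq : χ ^ 2 = 1) {M N : ℕ} (h : M ≤ N) : convSum χ M ≤ convSum χ N :=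
  Finset.sum_le_sum_of_subset_of_nonneg (Finset.Ioc_subset_Ioc_right h)
    fun n _ _ => coeff_nonneg χ hq n

/-- `convSum χ N ≥ 0`. [folklore] -/
theorem convSum_nonneg (hq : χ ^ 2 = 1) (N : ℕ) : 0 ≤ convSum χ N :=
  Finset.sum_nonneg fun n _ => coeff_nonneg χ hq n

/-- `LOne χ = L(1, χ)` as a real number (the real part). [folklore] -/
def LOne [NeZero q] : ℝ := (χ.LFunction 1).re

/-- `(LOne χ : ℂ) = L(1, χ)` for quadratic `χ ≠ 1` (`L(1, χ)` is real, tree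
`DirichletAbel.LFunction_ofReal_im_eq_zero`). [folklore] -/
theorem ofReal_LOne [NeZero q] (hχ : χ ≠ 1) (hq : χ ^ 2 = 1) : (LOne χ : ℂ) = χ.LFunction 1 := by
  have him : (χ.LFunction 1).im = 0 := by
    have := LFunction_ofReal_im_eq_zero χ hχ hq one_pos
    rwa [ofReal_one] at this
  exact Complex.ext (by simp [LOne]) (by simp [him])

/-- **`L(1, χ) > 0`** for quadratic `χ ≠ 1` (MV p. 102; Mathlib's non-vanishing on `Re s ≥ 1`
plus the intermediate value theorem, tree `DirichletAbel.LFunction_ofReal_re_pos_of_forall_ne_zero`).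
[cite: MontgomeryVaughan2007, §4.3 p. 102] -/
theorem LOne_pos [NeZero q] (hχ : χ ≠ 1) (hq : χ ^ 2 = 1) : 0 < LOne χ := by
  have := LFunction_ofReal_re_pos_of_forall_ne_zero χ hχ hq one_pos le_rfl fun σ h1 h2 => by
    have hσ : σ = 1 := le_antisymm h2 h1
    subst hσ
    rw [ofReal_one]
    exact χ.LFunction_apply_one_ne_zero hχ
  rwa [ofReal_one] at this

/-- **Mean value of `ζ ⋆ χ`, real form**: for quadratic `χ ≠ 1` mod `q` and all `N`,
`|∑_{n ≤ N} r(n) − N L(1, χ)| ≤ 5 q √N`. [cite: MontgomeryVaughan2007, §2.1 eq. (2.9); §4.3 (4.23), Thm. 4.8] -/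
theorem abs_convSum_sub_le [NeZero q] (hχ : χ ≠ 1) (hq : χ ^ 2 = 1) (N : ℕ) :
    |convSum χ N - N * LOne χ| ≤ 5 * q * Real.sqrt N := by
  have h := norm_sum_zetaMul_sub_le χ hχ N
  rw [← ofReal_convSum χ hq, ← ofReal_LOne χ hχ hq] at h
  have e : (convSum χ N : ℂ) - (N : ℂ) * (LOne χ : ℂ) = ((convSum χ N - N * LOne χ : ℝ) : ℂ) := by
    push_cast; ring
  rwa [e, Complex.norm_real, Real.norm_eq_abs] at h

end Literature.NumberTheory.LFunctions.ZetaMul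

end
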